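import Summits.KontsevichZagierPeriods.KontsevichZagierPeriods.Theorems.SoloBlindOctaCoverPrep
import Summits.KontsevichZagierPeriods.KontsevichZagierPeriods.Theorems.SoloBlindTwelveSporadicPullback
import HarnessLib

/-!
# The degree-six cover at level 24: the pull-back identity

For the map `G(W) = W(1-W⁴)/(κ C³)` of `SoloBlindOctaCoverPrep` we prove the pointwise pull-back
identity on `(0,1) \ {√2-1}`

  `t^{-5/6}(1-t)^{-1/2}|_{t=G(W)} · |G'(W)| = θ(W)`,  `θ(W) = λ · S(W) · E(W)`,

`λ = κ^{-1/6}`, `E(W) = (W(1-W⁴))^{-5/6}` the octahedral density of `SoloBlindOctaPrep` and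
`S = s₀ + s₁W - s₂W² - W³` — by comparing sixth powers of positive quantities, using
`1 - G = D²/C³` and `G' = -DS/(κC⁴)` — together with the integrability of `θ` (a cubic times
`E`, whose monomial pieces are transports of Beta integrands along `t = v⁴`) and the
semialgebraicity of `θ` and `G` on the two pieces `(0,√2-1)`, `(√2-1,1)`.
-/

noncomputable section

open Set MeasureTheory MvPolynomial

namespace Summit.KontsevichZagierPeriods.KontsevichZagierPeriods.Theorems

namespace SoloBlind

open Literature.ModelTheory.ExponentialFields (IsSemialgebraic)
open Literature.NumberTheory.Transcendental
open Literature.NumberTheory.Transcendental.KZ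

/-! ## The constant `λ = κ^{-1/6}` -/

/-- `λ = κ^{-1/6} ≈ 0.94773`. -/
def ocL : ℝ := ocKap ^ (-(1 / 6 : ℝ))

/-- `0 < λ`. -/
theorem ocL_pos : 0 < ocL := Real.rpow_pos_of_pos ocKap_pos _

/-- `λ⁶ = κ⁻¹`. -/
theorem ocL_pow_six : ocL ^ 6 = ocKap⁻¹ := by
  rw [ocL, rpow_pow_six ocKap_pos (k := -1) (by norm_num), zpow_neg_one]

/-- `λ` is algebraic. -/
theorem isAlgebraic_ocL : IsAlgebraic ℚ ocL := by
  have h := Literature.NumberTheory.Transcendental.isAlgebraic_rpow_ratCast isAlgebraic_ocKap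
    ocKap_pos (-(1 / 6))
  push_cast at h
  exact h

/-! ## The form `θ = λ S E` -/

/-- `θ(W) = λ · S(W) · E(W)`, the pull-back of the `B(1/6,1/2)`-integrand along `G`. -/
def ocTheta (W : ℝ) : ℝ := ocL * (ocS W * octE W)

/-- `E > 0` on `(0,1)`. -/
theorem octE_pos' {v : ℝ} (hv : v ∈ Ioo (0:ℝ) 1) : 0 < octE v :=
  Real.rpow_pos_of_pos (octP_pos hv) _

/-- `θ > 0` on `(0,1)`. -/
theorem ocTheta_pos {W : ℝ} (hW : W ∈ Ioo (0:ℝ) 1) : 0 < ocTheta W :=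
  mul_pos ocL_pos (mul_pos (ocS_pos hW.1.le hW.2.le) (octE_pos' hW))

/-- `θ⁶ = κ⁻¹ S⁶ (W(1-W⁴))⁻⁵`. -/
theorem ocTheta_pow_six {W : ℝ} (hW : W ∈ Ioo (0:ℝ) 1) :
    ocTheta W ^ 6 = ocKap⁻¹ * (ocS W ^ 6 * octP W ^ (-5:ℤ)) := by
  unfold ocTheta octE
  rw [mul_pow, mul_pow, ocL_pow_six, rpow_pow_six (octP_pos hW) (k := -5) (by norm_num)]

/-- The cubic `S` written out (for `ring`). -/
theorem ocS_eq (W : ℝ) : ocS W = ocS0 + ocS1 * W - ocS2 * W ^ 2 - W ^ 3 := rfl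

/-! ## The pull-back identity -/

/-- **Pull-back along `G`:** `t^{-5/6}(1-t)^{-1/2}|_{t=G} |G'| = θ` on `(0,1) \ {√2-1}`. -/
theorem oc_pull {W : ℝ} (hW : W ∈ Ioo (0:ℝ) 1) (hne : W ≠ r2 - 1) :
    ocTheta W = betaFun (1 / 6) (1 / 2) (ocG W) * |ocG' W| := by
  have h0 := hW.1.le
  have h1 := hW.2.le
  have hC := ocC_pos h0 h1
  have hK := ocKap_pos
  have hS := ocS_pos h0 h1
  have hD := ocD_ne_zero h0 hne
  have hP := octP_pos hW
  have hDa : 0 < |ocD W| := abs_pos.mpr hD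
  have hC' := hC.ne'
  have hK' := hK.ne'
  have hS' := hS.ne'
  have hP' := hP.ne'
  have hG : 0 < ocG W := (ocG_mem hW hne).1
  have hX : 0 < ocD W ^ 2 / ocC W ^ 3 := by positivity
  have hY : 0 < |ocD W| * ocS W / (ocKap * ocC W ^ 4) := by positivity
  rw [betaFun, one_sub_ocG h0 h1, abs_ocG' h0 h1]
  refine (pow_left_inj₀ (ocTheta_pos hW).le
    (mul_pos (mul_pos (Real.rpow_pos_of_pos hG _) (Real.rpow_pos_of_pos hX _)) hY).le
    (by norm_num : (6:ℕ) ≠ 0)).mp ?_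
  have hD6 : |ocD W| ^ 6 = ocD W ^ 6 := Even.pow_abs (by norm_num) _
  rw [ocTheta_pow_six hW, mul_pow, mul_pow,
    rpow_pow_six hG (k := -5) (by push_cast; norm_num),
    rpow_pow_six hX (k := -3) (by push_cast; norm_num), div_pow, mul_pow, hD6]
  simp only [ocG, zpow_neg, zpow_ofNat]
  field_simp

/-! ## Integrability -/

/-- `θ` is integrable on `(0,1)`: it is a combination of the transports `4v^jE(v)`. -/
theorem integrableOn_ocTheta : IntegrableOn ocTheta (Ioo 0 1) := by
  have h : IntegrableOn (fun v => ocL * (ocS0 / 4 * (4 * (v ^ 0 * octE v)) +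
      ocS1 / 4 * (4 * (v ^ 1 * octE v)) - ocS2 / 4 * (4 * (v ^ 2 * octE v)) -
      1 / 4 * (4 * (v ^ 3 * octE v)))) (Ioo 0 1) :=
    (((((integrableOn_octR 0).const_mul _).add ((integrableOn_octR 1).const_mul _)).sub
      ((integrableOn_octR 2).const_mul _)).sub ((integrableOn_octR 3).const_mul _)).const_mul ocL
  exact h.congr_fun (fun v _ => by simp only [ocTheta, ocS]; ring) measurableSet_Ioo

/-- `θ` is integrable on `(0, √2-1)`. -/
theorem integrableOn_ocTheta_left : IntegrableOn ocTheta (Ioo 0 (r2 - 1)) :=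
  integrableOn_ocTheta.mono_set (Ioo_subset_Ioo_right r2_sub_one_mem.2.le)

/-- `θ` is integrable on `(√2-1, 1)`. -/
theorem integrableOn_ocTheta_right : IntegrableOn ocTheta (Ioo (r2 - 1) 1) :=
  integrableOn_ocTheta.mono_set (Ioo_subset_Ioo_left r2_sub_one_mem.1.le)

/-! ## Semialgebraicity -/

/-- `√2 - 1` is algebraic. -/
theorem isAlgebraic_r2_sub_one : IsAlgebraic ℚ (r2 - 1) :=
  isAlgebraic_of_K₀ (r2K - 1) (by push_cast; rfl)

/-- `line (0, √2-1)` is `ℚ`-semialgebraic. -/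
theorem oc_lineL_sa : IsSemialgebraic ℚ (line (Ioo 0 (r2 - 1))) :=
  isSemialgebraic_line_Ioo isAlgebraic_zero isAlgebraic_r2_sub_one

/-- `line (√2-1, 1)` is `ℚ`-semialgebraic. -/
theorem oc_lineR_sa : IsSemialgebraic ℚ (line (Ioo (r2 - 1) 1)) :=
  isSemialgebraic_line_Ioo isAlgebraic_r2_sub_one isAlgebraic_one

/-- `E` is `ℚ`-semialgebraic on any `ℚ`-semialgebraic part of `(0,1)`. -/
theorem sa_octE_on {S : Set ℝ} (hS : IsSemialgebraic ℚ (line S)) (hsub : S ⊆ Ioo (0:ℝ) 1) :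
    IsSemialgebraicFunOn ℚ (line S) (fun x : Fin 1 → ℝ => octE (x 0)) := by
  have hP : IsSemialgebraicFunOn ℚ (line S) (fun x : Fin 1 → ℝ => octP (x 0)) :=
    (isSemialgebraicFunOn_aeval hS (X 0 * (1 - X 0 ^ 4) : MvPolynomial (Fin 1) ℚ)).congr
      fun x _ => by simp [octP]
  refine (IsSemialgebraicFunOn.rpow_ratCast hS hP (fun x hx => octP_pos (hsub hx))
    (-(5 / 6))).congr fun x _ => ?_
  simp only [octE]
  norm_num

/-- `S` is `ℚ`-semialgebraic on any `ℚ`-semialgebraic line set (a cubic with algebraic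
coefficients). -/
theorem sa_ocS {S : Set ℝ} (hS : IsSemialgebraic ℚ (line S)) :
    IsSemialgebraicFunOn ℚ (line S) (fun x : Fin 1 → ℝ => ocS (x 0)) := by
  have hX := sa_coord hS
  have h0 := isSemialgebraicFunOn_const_of_isAlgebraic hS isAlgebraic_ocS0
  have h1 := IsSemialgebraicFunOn.mul_holds
    (isSemialgebraicFunOn_const_of_isAlgebraic hS isAlgebraic_ocS1) hX
  have h2 := IsSemialgebraicFunOn.mul_holds
    (isSemialgebraicFunOn_const_of_isAlgebraic hS isAlgebraic_ocS2)
    (IsSemialgebraicFunOn.mul_holds hX hX)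
  have h3 := IsSemialgebraicFunOn.mul_holds (IsSemialgebraicFunOn.mul_holds hX hX) hX
  exact (IsSemialgebraicFunOn.sub_holds (IsSemialgebraicFunOn.sub_holds
    (IsSemialgebraicFunOn.add_holds h0 h1) h2) h3).congr fun x _ => by
      simp only [ocS, Pi.add_apply, Pi.sub_apply, Pi.mul_apply]; ring

/-- `θ` is `ℚ`-semialgebraic on any `ℚ`-semialgebraic part of `(0,1)`. -/
theorem sa_ocTheta {S : Set ℝ} (hS : IsSemialgebraic ℚ (line S)) (hsub : S ⊆ Ioo (0:ℝ) 1) :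
    IsSemialgebraicFunOn ℚ (line S) (fun x : Fin 1 → ℝ => ocTheta (x 0)) :=
  (IsSemialgebraicFunOn.mul_holds (isSemialgebraicFunOn_const_of_isAlgebraic hS isAlgebraic_ocL)
    (IsSemialgebraicFunOn.mul_holds (sa_ocS hS) (sa_octE_on hS hsub))).congr
    fun x _ => by simp only [ocTheta, Pi.mul_apply]

/-- `θ` on `line (0,1)`. -/
theorem sa_ocTheta_unit :
    IsSemialgebraicFunOn ℚ (line (Ioo (0:ℝ) 1)) (fun x => ocTheta (x 0)) :=
  sa_ocTheta mix_line_sa fun _ h => h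

/-- `θ` on `line (0, √2-1)`. -/
theorem sa_ocTheta_left :
    IsSemialgebraicFunOn ℚ (line (Ioo 0 (r2 - 1))) (fun x => ocTheta (x 0)) :=
  sa_ocTheta oc_lineL_sa fun _ h => ⟨h.1, h.2.trans r2_sub_one_mem.2⟩

/-- `θ` on `line (√2-1, 1)`. -/
theorem sa_ocTheta_right :
    IsSemialgebraicFunOn ℚ (line (Ioo (r2 - 1) 1)) (fun x => ocTheta (x 0)) :=
  sa_ocTheta oc_lineR_sa fun _ h => ⟨r2_sub_one_mem.1.trans h.1, h.2⟩

/-- `G` is `ℚ`-semialgebraic on any `ℚ`-semialgebraic part of `[0,1]` (a rational function with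
algebraic coefficients and non-vanishing denominator). -/
theorem sa_ocG {S : Set ℝ} (hS : IsSemialgebraic ℚ (line S)) (hsub : S ⊆ Icc (0:ℝ) 1) :
    IsSemialgebraicFunOn ℚ (line S) (fun x : Fin 1 → ℝ => ocG (x 0)) := by
  have hX := sa_coord hS
  have hP : IsSemialgebraicFunOn ℚ (line S) (fun x : Fin 1 → ℝ => octP (x 0)) :=
    (isSemialgebraicFunOn_aeval hS (X 0 * (1 - X 0 ^ 4) : MvPolynomial (Fin 1) ℚ)).congr
      fun x _ => by simp [octP]
  have hC : IsSemialgebraicFunOn ℚ (line S) (fun x : Fin 1 → ℝ => ocC (x 0)) :=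
    (IsSemialgebraicFunOn.add_holds
      (isSemialgebraicFunOn_aeval hS (X 0 ^ 2 + 1 : MvPolynomial (Fin 1) ℚ))
      (IsSemialgebraicFunOn.mul_holds
        (isSemialgebraicFunOn_const_of_isAlgebraic hS isAlgebraic_ocC1)
        (isSemialgebraicFunOn_aeval hS (X 0 + 1 : MvPolynomial (Fin 1) ℚ)))).congr
      fun x _ => by
        simp only [ocC, Pi.add_apply, Pi.mul_apply, map_add, map_pow, map_one, aeval_X]; ring
  have hD : IsSemialgebraicFunOn ℚ (line S) (fun x : Fin 1 → ℝ => ocKap * ocC (x 0) ^ 3) :=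
    (IsSemialgebraicFunOn.mul_holds
      (isSemialgebraicFunOn_const_of_isAlgebraic hS isAlgebraic_ocKap)
      (IsSemialgebraicFunOn.mul_holds (IsSemialgebraicFunOn.mul_holds hC hC) hC)).congr
      fun x _ => by simp only [Pi.mul_apply]; ring
  exact (IsSemialgebraicFunOn.div hP hD fun x hx =>
    (ocG_den_pos (hsub hx).1 (hsub hx).2).ne').congr fun x _ => by simp only [ocG]

/-- `G` on `line (0, √2-1)`. -/
theorem sa_ocG_left : IsSemialgebraicFunOn ℚ (line (Ioo 0 (r2 - 1))) (fun x => ocG (x 0)) :=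
  sa_ocG oc_lineL_sa fun _ h => ⟨h.1.le, (h.2.trans r2_sub_one_mem.2).le⟩

/-- `G` on `line (√2-1, 1)`. -/
theorem sa_ocG_right : IsSemialgebraicFunOn ℚ (line (Ioo (r2 - 1) 1)) (fun x => ocG (x 0)) :=
  sa_ocG oc_lineR_sa fun _ h => ⟨(r2_sub_one_mem.1.trans h.1).le, h.2.le⟩

end SoloBlind

end Summit.KontsevichZagierPeriods.KontsevichZagierPeriods.Theorems
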